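import Literature.MathematicalPhysics.QuantumFieldTheory.Balaban1983to89.B9Eq3126H1kPiOneBlockColumn
import Literature.MathematicalPhysics.QuantumFieldTheory.Balaban1983to89.B11Eq88LaplaceH1CurrentLetter
import Literature.MathematicalPhysics.QuantumFieldTheory.Balaban1983to89.B9Eq3119DeltaPiTowerFlat
import Literature.MathematicalPhysics.QuantumFieldTheory.Balaban1983to89.B9Eq315QTowerFlat
import Literature.MathematicalPhysics.QuantumFieldTheory.Balaban1983to89.B9Eq3117ConjugationDefects

/-!
# `Balaban1983to89.B11Ineq88KernelLettersFlatChain` — T. Bałaban, *Propagators for lattice gauge theories in a background field*, Commun. Math. Phys. **99** (1985)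
# 389–434 [Balaban1985BackgroundPropagators] (3.126) p. 420, (3.122) p. 420, (3.132) p. 422; *The variational problem and background fields in renormalization group method
# for lattice gauge theories*, Commun. Math. Phys. **102** (1985) 277–309 [Balaban1985Variational] (73) p. 289, (88) p. 291, Prop. 6 (117) p. 295:
# **THE ONE-BLOCK LETTERS OF THE CHAIN's VACUUM PAIR `H_{1,k}(1)`, `(Δ_{a,k}(1) − Q_k†aQ_k)∘H_{1,k}(1)` IN THE CHAIN's OWN SPELLING** — the one-background
# letters of `B9Eq3126H1kPiOneBlockColumn.exists_oneBlock_letter_H1LatticeCLM` ((3.126) one block: `‖(H̃_{1,k}δ_yZ)(b)‖ ≤ M_φBM_φ′e^{−δd}‖Z‖`) and of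
# `B11Eq88LaplaceH1CurrentLetter.exists_oneBlock_letter_laplaceH1_current` (the composite current `‖((Δ̃_{a,k} − Q†aQ)H̃_{1,k}δ_yZ)(b)‖₍₋₃₎ ≤ M_φBM_φ′e^{−δd}‖Z‖`)
# READ AT THE VACUUM `U ≡ 1` (print's class with `α = 0`, current `0`) AND RESPELLED in the chain's letters: print's operator at the vacuum IS the chain's
# (`B9Eq3119DeltaPiTowerFlat.laplaceAkPi_one_eq_laplaceAk_one`, `letters_laplaceAkPi_one`: `Δ̃_{a,k}(1) = Δ_{a,k}(1)`, `H̃_{1,k}(1) = H_{1,k}(1)`), so the letters hold for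
# `H1LatticeCLM (flat data) φ hpos₁ hQ1` and `currentCLM φ lev₁ Dc (Δ_{a,k}(1) − Q_k(1)†aQ_k(1))` — the vacuum slot of the two-background faces of this lineage
# (`B9Eq3133H1kPiTwoBackgroundOneBlockColumn`, `B11Eq88LaplaceH1CurrentTwoBackgroundOneBlockColumn`), with the SAME letter pair `(B, δ)` as at `U`.
# NE9 crux-team LEAF PROVER 01 (`b2b-balaban-t4-ne9-formalise-leaf-01`), gen 105; cell `pub-balaban`∕`t4`, row NE9, bears_on R4/N22; composition BY NAME; [folklore].

WHAT IS PROVED (sorry-free; 0 `def`): `J_flat_eq_zero` (the current of the vacuum vanishes), `H1LatticeCLM_laplaceAkPi_one` (the (115)-valued `H̃_{1,k}(1) = H_{1,k}(1)`, any witnesses),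
**`exists_oneBlock_letters_flat_chain`** (`∃ B δ` before the lattice; both one-block letters at the vacuum in the chain's spelling).  HONEST SCOPE: bookkeeping over LANDED
one-background letters at `U := 1`; nothing of [B9] (3.126)∕(3.132) or [B11] (73), (88) asserted as printed; «NE9 ⇐ the named binders»; NE9 NOT PRINTED ∕ NOT PROVED;
spine PROVED 0∕9; rung (B)+1 finite T⁴ — NOT infinite volume, NOT mass gap, NOT BetaPertH, NOT Clay.  HONEST DEPENDENCY: continuum YM on T⁴ ⇐ BetaPertH ∧ nine spine
estimates (0/9 proved); BetaPertH ⇐ (D1) ∧ (D4) ∧ CAP+tail; G-an2-4 gates asym, D1 and NE2/3/4.  NEW file; nothing modified.  Net new unproved facts: 0.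
-/

noncomputable section

open scoped InnerProductSpace ComplexConjugate BigOperators

namespace Literature.MathematicalPhysics.QuantumFieldTheory.Balaban1983to89.B11Ineq88KernelLettersFlatChain

universe uκ

open B4Sect5Torus (TSite tdist tdist_nonneg)
open B9SectCLatticeCarrier (Bond bpos shift unshift)
open B9Eq311L2Pairing (WL2)
open B9Eq319QprimeTorus (blockCoord)
open B7Prop1Explicit (U1 Wcx boxVec)
open B11Eq103H1Complex (SiteL2K BondL2K H1LatticeCLM)
open B9Eq310DeltaPrime (plaqHolU plaqHolU_one)
open B9Eq310HessianOperator (adTransportW hessOp)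
open B9Eq315QTorus (perCfg cornerSite)
open B9Eq315QTower (towerP UlevOf)
open B9Eq315QTowerFlat (UlevOf_one perCfg_UlevOf_one_mem_U1 norm_Wcx_UlevOf_one_sub_one_le)
open B9Eq316TowerFlatIsOneStep (towerP_eq_fineP_pow siteCast)
open B9Eq326OperatorTower (QkW laplaceAk RofUk)
open B9Eq324DeltaPrimeATower (laplacePrimeAk)
open B9Eq3119DeltaPiTower (laplaceAkPi)
open B9Eq3119DeltaPiTowerFlat (laplaceAkPi_one_eq_laplaceAk_one laplaceAkPi_one_pos_iff letters_laplaceAkPi_one)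
open B9Eq3126H1kPiOneBlockColumn (exists_oneBlock_letter_H1LatticeCLM)
open B11Eq88LaplaceH1CurrentLetter (exists_oneBlock_letter_laplaceH1_current)
open B9Eq3119DeltaPiCarrier (currentCLM)
open B9Eq39Adjoint (plaqU J)
open B9Eq37Insertion (imC imC_one)
open B9Eq3117ConjugationDefects (J_eq_sum)
open B11Eq115Space

variable {d : ℕ} (hd : 1 ≤ d) (L : ℕ) [NeZero L] (hL : 1 ≤ L) (hL3 : 3 ≤ L)
  {𝔸 : Type*} [NormedRing 𝔸] [NormedAlgebra ℂ 𝔸] [CompleteSpace 𝔸] [NormOneClass 𝔸] [StarRing 𝔸] [NormedStarGroup 𝔸] [StarModule ℂ 𝔸]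
  {W : Type*} [NormedAddCommGroup W] [InnerProductSpace ℂ W] [FiniteDimensional ℂ W] (φ : W ≃ₗ[ℂ] 𝔸)
  {Mφ Mφ' : ℝ} (hMφ : 0 ≤ Mφ) (hMφ' : 0 ≤ Mφ') (hφ : ∀ w, ‖φ w‖ ≤ Mφ * ‖w‖) (hφ' : ∀ X, ‖φ.symm X‖ ≤ Mφ' * ‖X‖) (hstar : ∀ X : 𝔸, ‖star X‖ ≤ ‖X‖)
  {a : ℝ} (ha : 0 < a) {a' : ℝ} (ha' : 0 < a') {ϱ : ℝ} (hϱ0 : 0 ≤ ϱ) (hϱ1 : ϱ < 1)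
  (τ : 𝔸 →ₗ[ℂ] ℂ) {Cτ : ℝ} (hτ : ∀ X, ‖τ X‖ ≤ Cτ * ‖X‖) (hCτ : 0 ≤ Cτ) {Mτ : ℝ} (hτm : ∀ X Y : 𝔸, ‖τ (X * Y)‖ ≤ Mτ * ‖X‖ * ‖Y‖) (hMτ : 0 ≤ Mτ)
  {ρw : ℝ} (hρw : 0 ≤ ρw)
  (hτ₁ : ∀ X : 𝔸, τ (star X) = conj (τ X)) (hτ₂ : ∀ X Y : 𝔸, τ (X * Y) = τ (Y * X)) (hφτ : ∀ X Y : 𝔸, ⟪φ.symm X, φ.symm Y⟫_ℂ = τ (star X * Y))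
  (AQ : ℝ)

/-! ## §1 The vacuum is in print's class with current `0`; print's `H̃_{1,k}(1)` is the chain's `H_{1,k}(1)` in the (115) type -/

section Flat

variable (m : Fin d → ℕ) [∀ i, NeZero (m i)] (n : ℕ) (η : ℝ)

omit [NeZero L] [CompleteSpace 𝔸] [NormOneClass 𝔸] [StarRing 𝔸] [NormedStarGroup 𝔸] [StarModule ℂ 𝔸] [∀ i, NeZero (m i)] in
/-- **The current of the vacuum vanishes**: `J(μ, y) = 0` at `U ≡ 1` ((3.11): every plaquette variable is `1`, `Im 1 = 0`). [folklore]
[cite: Balaban1985BackgroundPropagators, (3.11) p.392, (3.36) p.396] -/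
theorem J_flat_le_zero (μ : Fin d) (y : TSite d (towerP L m (n + 1))) :
    ‖J (fun μ => B9Eq33CovDerivVector.shiftEquiv (Pd := towerP L m (n + 1)) μ)
        (fun (μ : Fin d) (y : TSite d (towerP L m (n + 1))) => (fun _ : Bond d (towerP L m (n + 1)) => (1 : 𝔸ˣ)) (y, μ)) η μ y‖ ≤ 0 := by
  have h := J_eq_sum (Pd := towerP L m (n + 1)) (fun _ : Bond d (towerP L m (n + 1)) => (1 : 𝔸ˣ)) η μ y
  have hp : ∀ (κ ν : Fin d) (x : TSite d (towerP L m (n + 1))),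
      plaqU (fun μ => B9Eq33CovDerivVector.shiftEquiv (Pd := towerP L m (n + 1)) μ)
        (fun (μ : Fin d) (y : TSite d (towerP L m (n + 1))) => (fun _ : Bond d (towerP L m (n + 1)) => (1 : 𝔸ˣ)) (y, μ)) κ ν x = 1 := fun κ ν x => by
    simp [plaqU]
  simp only [hp, imC_one, mul_zero, zero_mul, sub_self, Finset.sum_const_zero, smul_zero] at h
  rw [h, norm_zero]

variable [Fact (0 < η)] [FiniteDimensional ℂ 𝔸] {c₀ c₁ : ℝ} [Fact (0 < c₀)] [Fact (0 < c₁)]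
  (hpos'₁ : ∀ x : SiteL2K ℂ d (towerP L m (n + 1)) c₀ W, x ≠ 0 →
    0 < RCLike.re ⟪x, laplacePrimeAk L m n φ η (fun _ : Bond d (towerP L m (n + 1)) => (1 : 𝔸ˣ)) a' (c₁ := c₁) x⟫_ℂ)
  (hpos₁ : ∀ x : BondL2K ℂ d (towerP L m (n + 1)) c₀ W, x ≠ 0 →
    0 < RCLike.re ⟪x, laplaceAk L m n φ η (fun _ : Bond d (towerP L m (n + 1)) => (1 : 𝔸ˣ)) hL (fun _ => 0) (fun _ => by norm_num)
      (perCfg_UlevOf_one_mem_U1 L m (n + 1)) (norm_Wcx_UlevOf_one_sub_one_le L m (n + 1) (fun _ => 0) (fun _ => le_rfl)) τ (c₀ := c₀) (c₁ := c₁) a x⟫_ℂ)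
  (hposπ₁ : ∀ x : BondL2K ℂ d (towerP L m (n + 1)) c₀ W, x ≠ 0 →
    0 < RCLike.re ⟪x, laplaceAkPi L m n φ τ η (fun _ : Bond d (towerP L m (n + 1)) => (1 : 𝔸ˣ)) a' hpos'₁ hL (fun _ => 0) (fun _ => by norm_num)
      (perCfg_UlevOf_one_mem_U1 L m (n + 1)) (norm_Wcx_UlevOf_one_sub_one_le L m (n + 1) (fun _ => 0) (fun _ => le_rfl)) (c₁ := c₁) a x⟫_ℂ)
  (hQ1 : Function.Surjective (QkW L m n φ (fun _ : Bond d (towerP L m (n + 1)) => (1 : 𝔸ˣ)) hL (fun _ => 0) (fun _ => by norm_num)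
    (perCfg_UlevOf_one_mem_U1 L m (n + 1)) (norm_Wcx_UlevOf_one_sub_one_le L m (n + 1) (fun _ => 0) (fun _ => le_rfl)) (c₀ := c₀) (c₁ := c₁)))
  (lev₀ : Bond d (towerP L m (n + 1)) → ℕ) (levB : Bond d m → ℕ) {κ' : Type*} [Fintype κ'] (lev₁ : κ' → ℕ)
  (Dc : (Bond d (towerP L m (n + 1)) → 𝔸) →ₗ[ℂ] (κ' → 𝔸)) [Fact (0 < (L : ℝ))]

omit [NormedStarGroup 𝔸] in
set_option maxRecDepth 8192 in
set_option maxHeartbeats 1600000 in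
/-- **`H̃_{1,k}(1) = H_{1,k}(1)` IN THE (115) TYPE** ((3.126) at the vacuum, under `H1LatticeCLM`, any positivity ∕ onto witnesses): `B9Eq3119DeltaPiTowerFlat.letters_laplaceAkPi_one`.
[folklore] [cite: Balaban1985BackgroundPropagators, (3.122) p.420, (3.126) p.420] -/
theorem H1LatticeCLM_laplaceAkPi_one :
    H1LatticeCLM (L := (L : ℝ)) (η := η) (lev₀ := lev₀) (levB := levB) φ hposπ₁ hQ1 lev₁ Dc =
      H1LatticeCLM (L := (L : ℝ)) (η := η) (lev₀ := lev₀) (levB := levB) (c := ((η : ℂ))⁻¹)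
              (R := adTransportW φ (fun _ : Bond d (towerP L m (n + 1)) => (1 : 𝔸ˣ)))
              (S := adTransportW φ fun _ : Bond d (towerP L m (n + 1)) => (1 : 𝔸ˣ)⁻¹) (Δ₁ := hessOp φ η (fun _ : Bond d (towerP L m (n + 1)) => (1 : 𝔸ˣ)) τ)
              (Rr := RofUk L m n φ η (fun _ : Bond d (towerP L m (n + 1)) => (1 : 𝔸ˣ)))
              (Q := (QkW L m n φ (fun _ : Bond d (towerP L m (n + 1)) => (1 : 𝔸ˣ)) hL (fun _ => 0) (fun _ => by norm_num)
                (perCfg_UlevOf_one_mem_U1 L m (n + 1)) (norm_Wcx_UlevOf_one_sub_one_le L m (n + 1) (fun _ => 0) (fun _ => le_rfl)) (c₀ := c₀) (c₁ := c₁))) (a := a)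
              φ hpos₁ hQ1 lev₁ Dc := by
  have h := letters_laplaceAkPi_one L m n φ τ η a' hpos'₁ hL (fun _ => 0) (fun _ => by norm_num) (perCfg_UlevOf_one_mem_U1 L m (n + 1))
    (norm_Wcx_UlevOf_one_sub_one_le L m (n + 1) (fun _ => 0) (fun _ => le_rfl)) a hposπ₁ hpos₁ hQ1
  unfold H1LatticeCLM
  rw [h.2.2.1]

end Flat

/-! ## §2 Both one-block letters at the vacuum, in the chain's spelling -/

set_option maxRecDepth 8192 in
set_option maxHeartbeats 3200000 in
include hd hL3 hMφ hMφ' hφ hφ' hstar ha ha' hϱ0 hϱ1 hτ hCτ hτm hMτ hρw hτ₁ hτ₂ hφτ in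
/-- **THE ONE-BLOCK LETTERS OF THE CHAIN's VACUUM PAIR** — `∃ (B, δ)` BEFORE the lattice (the SAME pair serves at every background of print's class, in particular at `U`),
then for every lattice `(n, η, m)` of the tower with `ηL^{n+1} = 1`, any witnesses `hpos′₁, hpos₁, hQ1` at the vacuum, every carrier data and every `(y, Z, b)`:
`‖(H_{1,k}(1)δ_yZ)(b)‖ ≤ M_φBM_φ′e^{−δ·d_m(Π(b₋), y₋)}‖Z‖` and `‖((Δ_{a,k}(1) − Q_k(1)†aQ_k(1))H_{1,k}(1)δ_yZ)(b)‖·(L^{j(b)}η)³ ≤ M_φBM_φ′e^{−δ·d_m(Π(b₋), y₋)}‖Z‖` — the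
one-background letters at `U := 1` (class data `α = 0`, `j₀ = 0`) respelled by §1. [cite: Balaban1985BackgroundPropagators, (3.126) p.420, (3.132) p.422, (3.122) p.420; Balaban1985Variational, (73) p.289, (88) p.291] -/
theorem exists_oneBlock_letters_flat_chain :
    ∃ α₁ j₁ B δ : ℝ, 0 < α₁ ∧ 0 < j₁ ∧ 0 ≤ B ∧ 0 < δ ∧
      (∀ (n : ℕ) (η : ℝ) (_hηL : η * (L : ℝ) ^ (n + 1) = 1) (c₀ c₁ : ℝ) [Fact (0 < c₀)] [Fact (0 < c₁)]
        (_hw : c₀ * ((L : ℝ) ^ (n + 1)) ^ d = c₁) (_hρ : |η| ^ d / c₀ ≤ ρw) (m : Fin d → ℕ) [∀ i, NeZero (m i)] (_hm : ∀ i, 1 ≤ m i)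
        (U : Bond d (towerP L m (n + 1)) → 𝔸ˣ) (αU : ℕ → ℝ) (_hα0 : ∀ j, 0 ≤ αU j) (hα1 : ∀ j, αU j ≤ 1 / 64)
        (hαL : ∀ j, 50 * (d + 1) * αU j * (L : ℝ) ^ d ≤ 1 / 2)
        (hU1 : ∀ (j : ℕ) (x : B7Prop1Explicit.Site d) (k : Fin d), perCfg (towerP L m (j + 1)) (UlevOf L m (n + 1) U j) x k ∈ U1 𝔸)
        (hreg : ∀ (j : ℕ) (y : TSite d (towerP L m j)) (k : Fin d) (ρ' : Fin d → Fin L),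
          ‖((Wcx L (perCfg (towerP L m (j + 1)) (UlevOf L m (n + 1) U j)) (cornerSite L y) k (boxVec L ρ') : 𝔸ˣ) : 𝔸) - 1‖ ≤ αU j)
        (εU : ℕ → ℝ) (_hεU : ∀ j, 0 ≤ εU j) (_hUε : ∀ (j : ℕ) (b : Bond d (towerP L m (j + 1))), ‖(UlevOf L m (n + 1) U j b : 𝔸) - 1‖ ≤ εU j)
        (_hLb : ∀ (j : ℕ) (b : Bond d (towerP L m (j + 1))), UlevOf L m (n + 1) U j b ∈ U1 𝔸)
        (α : ℝ) (_hα : 0 ≤ α) (_hαle : α ≤ α₁)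
        (hUst : ∀ b, star (U b : 𝔸) = (((U b)⁻¹ : 𝔸ˣ) : 𝔸)) (_hUb : ∀ b, U b ∈ U1 𝔸) (_hUη : ∀ b, ‖(U b : 𝔸) - 1‖ ≤ α * η)
        (_hpl : ∀ p : B9SectCLatticeCarrier.Plaq d (towerP L m (n + 1)), ‖(plaqHolU U p : 𝔸) - 1‖ ≤ α * η ^ 2)
        (_hUgrad : ∀ (x : TSite d (towerP L m (n + 1))) (μ : Fin d), ‖(U (x, μ) : 𝔸) - U (unshift μ x, μ)‖ ≤ α * η ^ 2)
        (_hRlev : ∀ (j : ℕ) (b : Bond d (towerP L m (j + 1))) (w : W), ‖adTransportW φ (UlevOf L m (n + 1) U j) b w‖ ≤ ‖w‖)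
        (_hεg : ∀ j < n + 1, εU j ≤ α * ϱ ^ j) (_hAQ : ∑ j ∈ Finset.range (n + 1), αU j ≤ AQ)
        (hpos' : ∀ x : SiteL2K ℂ d (towerP L m (n + 1)) c₀ W, x ≠ 0 → 0 < RCLike.re ⟪x, laplacePrimeAk L m n φ η U a' (c₁ := c₁) x⟫_ℂ)
        (hpos : ∀ x : BondL2K ℂ d (towerP L m (n + 1)) c₀ W, x ≠ 0 →
          0 < RCLike.re ⟪x, laplaceAk L m n φ η U hL αU hα1 hU1 hreg τ (c₀ := c₀) (c₁ := c₁) a x⟫_ℂ)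
        (_hc₀η : c₀ = η ^ d) (j₀ : ℝ) (_hJ : ∀ μ y, ‖B9Eq39Adjoint.J (fun μ => B9Eq33CovDerivVector.shiftEquiv μ) (fun μ y => U (y, μ)) η μ y‖ ≤ j₀) (_hj : j₀ ≤ j₁)
        (hposπ : ∀ x : BondL2K ℂ d (towerP L m (n + 1)) c₀ W, x ≠ 0 →
          0 < RCLike.re ⟪x, laplaceAkPi L m n φ τ η U a' hpos' hL αU hα1 hU1 hreg (c₁ := c₁) a x⟫_ℂ)
        (hQ : Function.Surjective (QkW L m n φ U hL αU hα1 hU1 hreg (c₀ := c₀) (c₁ := c₁)))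
        [FiniteDimensional ℂ 𝔸] (lev₀ : Bond d (towerP L m (n + 1)) → ℕ) {κ' : Type uκ} [Fintype κ'] (lev₁ : κ' → ℕ)
        (Dc : (Bond d (towerP L m (n + 1)) → 𝔸) →ₗ[ℂ] (κ' → 𝔸)) (levB : Bond d m → ℕ) [Fact (0 < (L : ℝ))] [Fact (0 < η)]
        (y : Bond d m) (Z : 𝔸) (b : Bond d (towerP L m (n + 1))),
        ‖JetSup.equiv (levWeight (L : ℝ) η lev₀ 1) (levWeight (L : ℝ) η lev₁ 2) Dc
            (H1LatticeCLM (L := (L : ℝ)) (η := η) (lev₀ := lev₀) (levB := levB) φ hposπ hQ lev₁ Dc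
              ((NegSup.equiv (levWeight (L : ℝ) η levB 0) 𝔸).symm (Pi.single y Z))) b‖ ≤
          Mφ * B * Mφ' * Real.exp (-(δ * tdist m (blockCoord (L ^ (n + 1)) m (siteCast (towerP_eq_fineP_pow L m (n + 1)) (bpos b))) (bpos y))) * ‖Z‖ ∧
        ‖NegSup.equiv (levWeight (L : ℝ) η lev₀ 3) 𝔸
            (currentCLM φ lev₁ Dc
              (laplaceAkPi L m n φ τ η U a' hpos' hL αU hα1 hU1 hreg (c₁ := c₁) a
                - LinearMap.adjoint (QkW L m n φ U hL αU hα1 hU1 hreg (c₀ := c₀) (c₁ := c₁)) ∘ₗ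
                    ((a : ℂ) • QkW L m n φ U hL αU hα1 hU1 hreg (c₀ := c₀) (c₁ := c₁)))
              (H1LatticeCLM (L := (L : ℝ)) (η := η) (lev₀ := lev₀) (levB := levB) φ hposπ hQ lev₁ Dc
                ((NegSup.equiv (levWeight (L : ℝ) η levB 0) 𝔸).symm (Pi.single y Z)))) b‖ ≤
          Mφ * B * Mφ' * Real.exp (-(δ * tdist m (blockCoord (L ^ (n + 1)) m (siteCast (towerP_eq_fineP_pow L m (n + 1)) (bpos b))) (bpos y))) * ‖Z‖) ∧
      (0 ≤ AQ → ∀ (n : ℕ) (η : ℝ) [Fact (0 < η)] (_hηL : η * (L : ℝ) ^ (n + 1) = 1) (c₀ c₁ : ℝ) [Fact (0 < c₀)] [Fact (0 < c₁)]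
        (_hw : c₀ * ((L : ℝ) ^ (n + 1)) ^ d = c₁) (_hρ : |η| ^ d / c₀ ≤ ρw) (m : Fin d → ℕ) [∀ i, NeZero (m i)] (_hm : ∀ i, 1 ≤ m i)
        (hpos'₁ : ∀ x : SiteL2K ℂ d (towerP L m (n + 1)) c₀ W, x ≠ 0 →
          0 < RCLike.re ⟪x, laplacePrimeAk L m n φ η (fun _ : Bond d (towerP L m (n + 1)) => (1 : 𝔸ˣ)) a' (c₁ := c₁) x⟫_ℂ)
        (hpos₁ : ∀ x : BondL2K ℂ d (towerP L m (n + 1)) c₀ W, x ≠ 0 →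
          0 < RCLike.re ⟪x, laplaceAk L m n φ η (fun _ : Bond d (towerP L m (n + 1)) => (1 : 𝔸ˣ)) hL (fun _ => 0) (fun _ => by norm_num)
            (perCfg_UlevOf_one_mem_U1 L m (n + 1)) (norm_Wcx_UlevOf_one_sub_one_le L m (n + 1) (fun _ => 0) (fun _ => le_rfl)) τ
            (c₀ := c₀) (c₁ := c₁) a x⟫_ℂ)
        (_hc₀η : c₀ = η ^ d)
        (hQ1 : Function.Surjective (QkW L m n φ (fun _ : Bond d (towerP L m (n + 1)) => (1 : 𝔸ˣ)) hL (fun _ => 0) (fun _ => by norm_num)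
          (perCfg_UlevOf_one_mem_U1 L m (n + 1)) (norm_Wcx_UlevOf_one_sub_one_le L m (n + 1) (fun _ => 0) (fun _ => le_rfl)) (c₀ := c₀) (c₁ := c₁)))
        [FiniteDimensional ℂ 𝔸] (lev₀ : Bond d (towerP L m (n + 1)) → ℕ) {κ' : Type uκ} [Fintype κ'] (lev₁ : κ' → ℕ)
        (Dc : (Bond d (towerP L m (n + 1)) → 𝔸) →ₗ[ℂ] (κ' → 𝔸)) (levB : Bond d m → ℕ) [Fact (0 < (L : ℝ))]
        (y : Bond d m) (Z : 𝔸) (b : Bond d (towerP L m (n + 1))),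
        ‖JetSup.equiv (levWeight (L : ℝ) η lev₀ 1) (levWeight (L : ℝ) η lev₁ 2) Dc
            (H1LatticeCLM (L := (L : ℝ)) (η := η) (lev₀ := lev₀) (levB := levB) (c := ((η : ℂ))⁻¹)
              (R := adTransportW φ (fun _ : Bond d (towerP L m (n + 1)) => (1 : 𝔸ˣ)))
              (S := adTransportW φ fun _ : Bond d (towerP L m (n + 1)) => (1 : 𝔸ˣ)⁻¹) (Δ₁ := hessOp φ η (fun _ : Bond d (towerP L m (n + 1)) => (1 : 𝔸ˣ)) τ)
              (Rr := RofUk L m n φ η (fun _ : Bond d (towerP L m (n + 1)) => (1 : 𝔸ˣ)))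
              (Q := (QkW L m n φ (fun _ : Bond d (towerP L m (n + 1)) => (1 : 𝔸ˣ)) hL (fun _ => 0) (fun _ => by norm_num)
                (perCfg_UlevOf_one_mem_U1 L m (n + 1)) (norm_Wcx_UlevOf_one_sub_one_le L m (n + 1) (fun _ => 0) (fun _ => le_rfl)) (c₀ := c₀) (c₁ := c₁))) (a := a)
              φ hpos₁ hQ1 lev₁ Dc ((NegSup.equiv (levWeight (L : ℝ) η levB 0) 𝔸).symm (Pi.single y Z))) b‖ ≤
          Mφ * B * Mφ' * Real.exp (-(δ * tdist m (blockCoord (L ^ (n + 1)) m (siteCast (towerP_eq_fineP_pow L m (n + 1)) (bpos b))) (bpos y))) * ‖Z‖ ∧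
        ‖NegSup.equiv (levWeight (L : ℝ) η lev₀ 3) 𝔸
            (currentCLM φ lev₁ Dc
              (laplaceAk L m n φ η (fun _ : Bond d (towerP L m (n + 1)) => (1 : 𝔸ˣ)) hL (fun _ => 0) (fun _ => by norm_num)
                  (perCfg_UlevOf_one_mem_U1 L m (n + 1)) (norm_Wcx_UlevOf_one_sub_one_le L m (n + 1) (fun _ => 0) (fun _ => le_rfl)) τ (c₀ := c₀) (c₁ := c₁) a
                - LinearMap.adjoint (QkW L m n φ (fun _ : Bond d (towerP L m (n + 1)) => (1 : 𝔸ˣ)) hL (fun _ => 0) (fun _ => by norm_num)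
                    (perCfg_UlevOf_one_mem_U1 L m (n + 1)) (norm_Wcx_UlevOf_one_sub_one_le L m (n + 1) (fun _ => 0) (fun _ => le_rfl)) (c₀ := c₀) (c₁ := c₁)) ∘ₗ
                    ((a : ℂ) • (QkW L m n φ (fun _ : Bond d (towerP L m (n + 1)) => (1 : 𝔸ˣ)) hL (fun _ => 0) (fun _ => by norm_num)
                      (perCfg_UlevOf_one_mem_U1 L m (n + 1)) (norm_Wcx_UlevOf_one_sub_one_le L m (n + 1) (fun _ => 0) (fun _ => le_rfl)) (c₀ := c₀) (c₁ := c₁))))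
              (H1LatticeCLM (L := (L : ℝ)) (η := η) (lev₀ := lev₀) (levB := levB) (c := ((η : ℂ))⁻¹)
                (R := adTransportW φ (fun _ : Bond d (towerP L m (n + 1)) => (1 : 𝔸ˣ)))
                (S := adTransportW φ fun _ : Bond d (towerP L m (n + 1)) => (1 : 𝔸ˣ)⁻¹) (Δ₁ := hessOp φ η (fun _ : Bond d (towerP L m (n + 1)) => (1 : 𝔸ˣ)) τ)
                (Rr := RofUk L m n φ η (fun _ : Bond d (towerP L m (n + 1)) => (1 : 𝔸ˣ)))
                (Q := (QkW L m n φ (fun _ : Bond d (towerP L m (n + 1)) => (1 : 𝔸ˣ)) hL (fun _ => 0) (fun _ => by norm_num)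
                  (perCfg_UlevOf_one_mem_U1 L m (n + 1)) (norm_Wcx_UlevOf_one_sub_one_le L m (n + 1) (fun _ => 0) (fun _ => le_rfl)) (c₀ := c₀) (c₁ := c₁))) (a := a)
                φ hpos₁ hQ1 lev₁ Dc ((NegSup.equiv (levWeight (L : ℝ) η levB 0) 𝔸).symm (Pi.single y Z)))) b‖ ≤
          Mφ * B * Mφ' * Real.exp (-(δ * tdist m (blockCoord (L ^ (n + 1)) m (siteCast (towerP_eq_fineP_pow L m (n + 1)) (bpos b))) (bpos y))) * ‖Z‖) := by
  classical
  obtain ⟨α₁H, j₁H, BH, δH, hα₁H, hj₁H, hBH, hδH, HB⟩ :=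
    exists_oneBlock_letter_H1LatticeCLM hd L hL hL3 φ hMφ hMφ' hφ hφ' hstar ha ha' hϱ0 hϱ1 τ hτ hCτ hτm hMτ hρw hτ₁ hτ₂ hφτ AQ
  obtain ⟨α₁N, j₁N, BN, δN, hα₁N, hj₁N, hBN, hδN, HN⟩ :=
    exists_oneBlock_letter_laplaceH1_current hd L hL hL3 φ hMφ hMφ' hφ hφ' hstar ha ha' hϱ0 hϱ1 τ hτ hCτ hτm hMτ hρw hτ₁ hτ₂ hφτ AQ
  -- ONE letter pair for both one-block letters: `B := max B_H B_N`, `δ := min δ_H δ_N`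
  have hweak : ∀ {B₀ δ₀ : ℝ}, 0 ≤ B₀ → B₀ ≤ max BH BN → min δH δN ≤ δ₀ → ∀ (t : ℝ), 0 ≤ t → ∀ (z : ℝ), 0 ≤ z →
      Mφ * B₀ * Mφ' * Real.exp (-(δ₀ * t)) * z ≤ Mφ * max BH BN * Mφ' * Real.exp (-(min δH δN * t)) * z := by
    intro B₀ δ₀ hB₀ hB₀B hδδ₀ t ht z hz
    have h1 : Real.exp (-(δ₀ * t)) ≤ Real.exp (-(min δH δN * t)) := Real.exp_le_exp.2 (neg_le_neg (mul_le_mul_of_nonneg_right hδδ₀ ht))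
    have h2 : Mφ * B₀ * Mφ' ≤ Mφ * max BH BN * Mφ' := mul_le_mul_of_nonneg_right (mul_le_mul_of_nonneg_left hB₀B hMφ) hMφ'
    exact mul_le_mul_of_nonneg_right (mul_le_mul h2 h1 (Real.exp_nonneg _) (by positivity)) hz
  refine ⟨min α₁H α₁N, min j₁H j₁N, max BH BN, min δH δN, lt_min hα₁H hα₁N, lt_min hj₁H hj₁N, hBH.trans (le_max_left _ _), lt_min hδH hδN, ?_, ?_⟩
  · intro n η hηL c₀ c₁ _ _ hw hρ m _ hm U αU hα0 hα1 hαL hU1 hreg εU hεU hUε hLb α hα hαle hUst hUb hUη hpl hUgrad hRlev hεg hAQ hpos' hpos hc₀η j₀ hJ hj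
      hposπ hQ _ lev₀ κ' _ lev₁ Dc levB _ _ y Z b
    exact ⟨(HB n η hηL c₀ c₁ hw hρ m hm U αU hα0 hα1 hαL hU1 hreg εU hεU hUε hLb α hα (hαle.trans (min_le_left _ _)) hUst hUb hUη hpl hUgrad hRlev hεg hAQ hpos'
        hpos hc₀η j₀ hJ (hj.trans (min_le_left _ _)) hposπ hQ lev₀ lev₁ Dc levB y Z b).trans
        (hweak hBH (le_max_left _ _) (min_le_left _ _) _ (tdist_nonneg _ _ _) _ (norm_nonneg Z)),
      (HN n η hηL c₀ c₁ hw hρ m hm U αU hα0 hα1 hαL hU1 hreg εU hεU hUε hLb α hα (hαle.trans (min_le_right _ _)) hUst hUb hUη hpl hUgrad hRlev hεg hAQ hpos'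
        hpos hc₀η j₀ hJ (hj.trans (min_le_right _ _)) hposπ hQ lev₀ lev₁ Dc levB y Z b).trans
        (hweak hBN (le_max_right _ _) (min_le_right _ _) _ (tdist_nonneg _ _ _) _ (norm_nonneg Z))⟩
  · intro hAQ n η _ hηL c₀ c₁ _ _ hw hρ m _ hm hpos'₁ hpos₁ hc₀η hQ1 _ lev₀ κ' _ lev₁ Dc levB _ y Z b
    -- the vacuum is in print's class with `α = 0`, `j₀ = 0`
    have hαL1 : ∀ j : ℕ, 50 * (d + 1) * (fun _ : ℕ => (0 : ℝ)) j * (L : ℝ) ^ d ≤ 1 / 2 := fun _ => by norm_num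
    have hUε1 : ∀ (j : ℕ) (b' : Bond d (towerP L m (j + 1))),
        ‖(UlevOf L m (n + 1) (fun _ : Bond d (towerP L m (n + 1)) => (1 : 𝔸ˣ)) j b' : 𝔸) - 1‖ ≤ (fun _ : ℕ => (0 : ℝ)) j := fun j b' => by
      rw [UlevOf_one]; simp
    have hLb1 : ∀ (j : ℕ) (b' : Bond d (towerP L m (j + 1))), UlevOf L m (n + 1) (fun _ : Bond d (towerP L m (n + 1)) => (1 : 𝔸ˣ)) j b' ∈ U1 𝔸 :=
      fun j b' => by rw [UlevOf_one]; exact one_mem _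
    have hRlev1 : ∀ (j : ℕ) (b' : Bond d (towerP L m (j + 1))) (w : W),
        ‖adTransportW φ (UlevOf L m (n + 1) (fun _ : Bond d (towerP L m (n + 1)) => (1 : 𝔸ˣ)) j) b' w‖ ≤ ‖w‖ := fun j b' w => by
      rw [UlevOf_one, B5Eq172HodgePositivity.adTransportW_one, LinearMap.id_apply]
    have hUst1 : ∀ b' : Bond d (towerP L m (n + 1)), star ((fun _ : Bond d (towerP L m (n + 1)) => (1 : 𝔸ˣ)) b' : 𝔸) =
        ((((fun _ : Bond d (towerP L m (n + 1)) => (1 : 𝔸ˣ)) b')⁻¹ : 𝔸ˣ) : 𝔸) := fun _ => by simp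
    have hUb1 : ∀ b' : Bond d (towerP L m (n + 1)), (fun _ : Bond d (towerP L m (n + 1)) => (1 : 𝔸ˣ)) b' ∈ U1 𝔸 := fun _ => one_mem _
    have hUη1 : ∀ b' : Bond d (towerP L m (n + 1)), ‖((fun _ : Bond d (towerP L m (n + 1)) => (1 : 𝔸ˣ)) b' : 𝔸) - 1‖ ≤ 0 * η := fun _ => by simp
    have hpl1 : ∀ p : B9SectCLatticeCarrier.Plaq d (towerP L m (n + 1)), ‖(plaqHolU (fun _ : Bond d (towerP L m (n + 1)) => (1 : 𝔸ˣ)) p : 𝔸) - 1‖ ≤ 0 * η ^ 2 :=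
      fun p => by rw [plaqHolU_one, Units.val_one, sub_self, norm_zero, zero_mul]
    have hUgrad1 : ∀ (x : TSite d (towerP L m (n + 1))) (μ : Fin d),
        ‖((fun _ : Bond d (towerP L m (n + 1)) => (1 : 𝔸ˣ)) (x, μ) : 𝔸) - (fun _ : Bond d (towerP L m (n + 1)) => (1 : 𝔸ˣ)) (unshift μ x, μ)‖ ≤ 0 * η ^ 2 :=
      fun x μ => by simp
    have hεg1 : ∀ j < n + 1, (fun _ : ℕ => (0 : ℝ)) j ≤ 0 * ϱ ^ j := fun _ _ => by simp
    have hAQ1 : ∑ j ∈ Finset.range (n + 1), (fun _ : ℕ => (0 : ℝ)) j ≤ AQ := by simpa using hAQ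
    have hJ1 := J_flat_le_zero L m n η (𝔸 := 𝔸)
    have hposπ₁ := (laplaceAkPi_one_pos_iff L m n φ τ η a' hpos'₁ hL (fun _ => 0) (fun _ => by norm_num)
      (perCfg_UlevOf_one_mem_U1 L m (n + 1)) (norm_Wcx_UlevOf_one_sub_one_le L m (n + 1) (fun _ => 0) (fun _ => le_rfl)) a (c₀ := c₀)).mpr hpos₁
    -- the two one-background letters at `U := 1` (print's spelling)
    have hB := HB n η hηL c₀ c₁ hw hρ m hm (fun _ : Bond d (towerP L m (n + 1)) => (1 : 𝔸ˣ)) (fun _ => 0) (fun _ => le_rfl) (fun _ => by norm_num) hαL1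
      (perCfg_UlevOf_one_mem_U1 L m (n + 1)) (norm_Wcx_UlevOf_one_sub_one_le L m (n + 1) (fun _ => 0) (fun _ => le_rfl)) (fun _ => 0) (fun _ => le_rfl) hUε1 hLb1
      0 le_rfl hα₁H.le hUst1 hUb1 hUη1 hpl1 hUgrad1 hRlev1 hεg1 hAQ1 hpos'₁ hpos₁ hc₀η 0 hJ1 hj₁H.le hposπ₁ hQ1 lev₀ lev₁ Dc levB y Z b
    have hN := HN n η hηL c₀ c₁ hw hρ m hm (fun _ : Bond d (towerP L m (n + 1)) => (1 : 𝔸ˣ)) (fun _ => 0) (fun _ => le_rfl) (fun _ => by norm_num) hαL1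
      (perCfg_UlevOf_one_mem_U1 L m (n + 1)) (norm_Wcx_UlevOf_one_sub_one_le L m (n + 1) (fun _ => 0) (fun _ => le_rfl)) (fun _ => 0) (fun _ => le_rfl) hUε1 hLb1
      0 le_rfl hα₁N.le hUst1 hUb1 hUη1 hpl1 hUgrad1 hRlev1 hεg1 hAQ1 hpos'₁ hpos₁ hc₀η 0 hJ1 hj₁N.le hposπ₁ hQ1 lev₀ lev₁ Dc levB y Z b
    -- respelled in the chain's letters: `H̃_{1,k}(1) = H_{1,k}(1)` first (it carries the witness `hposπ₁`), then `Δ̃_{a,k}(1) = Δ_{a,k}(1)`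
    rw [H1LatticeCLM_laplaceAkPi_one L hL φ τ m n η hpos'₁ hpos₁ hposπ₁ hQ1 lev₀ levB lev₁ Dc] at hB hN
    rw [laplaceAkPi_one_eq_laplaceAk_one] at hN
    exact ⟨hB.trans (hweak hBH (le_max_left _ _) (min_le_left _ _) _ (tdist_nonneg _ _ _) _ (norm_nonneg Z)),
      hN.trans (hweak hBN (le_max_right _ _) (min_le_right _ _) _ (tdist_nonneg _ _ _) _ (norm_nonneg Z))⟩

end Literature.MathematicalPhysics.QuantumFieldTheory.Balaban1983to89.B11Ineq88KernelLettersFlatChain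

end
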